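import Summits.QuantumFields.YangMills.Theses.SamplerStability

/-!
# Negative knowledge for the crux `SpecificationRate` (stmt-QuantumFields-28041):
# the `h`-weighted conditional Bernstein bridge of skeleton line «bernstein_rate» is false

The second skeleton line on `Summit.QuantumFields.YangMills.Theses.SamplerStability.SpecificationRate`
(ideator seat ym-idea-5 g9, LINE 12 «bernstein_rate», `pub/ideators/ym-idea-5/lineK12-bernstein_rate/`)
registered on stmt-QuantumFields-28041 the stub `stub_conditionalBernstein : ConditionalBernstein`, rated
"M, provable": for every probability measure `μ` on the unit-lattice gauge fields, every link `e` and every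
positive density `h` whose conditionally centred log-increment `X_e = log h − E_μ[log h | links ≠ e]` has a
one-sided ceiling `X_e ≤ η` a.e., the heat-bath energy at `e` is bounded by the **`h`-weighted** conditional
second moment: `∫ h dμ − ∫ (E_μ[√h | links ≠ e])² dμ ≤ (e^{max(η,0)}/2) · ∫ h · X_e² dμ`.

This file refutes that statement (`stub_conditionalBernstein_false`) with a two-atom witness: the block size
`L = 3`, `m = 1` family `F₀`, the link `e₀` at the origin in direction `0`, the configurations `V₀ ≡ 1` and
`V₁ = V₀[e₀ ↦ −1]` (same environment, so every conditional expectation given the links `≠ e₀` is the plain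
`μ₀`-mean), `μ₀ = 0.999·δ_{V₀} + 0.001·δ_{V₁}`, `h = 1` off `{V e₀ = −1}` and `h = e^{−10}` on it, `η = 1/100`.
Then the energy is `0.999 + 0.001e^{−10} − (0.999 + 0.001e^{−5})² ≥ 9.79·10⁻⁴` while the right-hand side is
`(e^{0.01}/2)(0.999·10⁻⁴ + 0.001·e^{−10}·9.99²) ≤ 1.65·10⁻⁴`.  The ratio grows like `e^{t}/t²` along the
family (`h = e^{−t}` on an atom of mass `q`), so no constant `C(η)` repairs the `h`-weighted form; the TRUE
bridge carries the weight `m_e = exp E_μ[log h | env]` (equivalently `E_μ[h | env] · E_μ[X_e² | env]`), under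
which large downward increments are NOT free.  Nothing here asserts a Theses statement; the crux
`SpecificationRate` itself is untouched.
-/

noncomputable section

open MeasureTheory
open Literature.MathematicalPhysics.QuantumFieldTheory.Balaban1983to89

namespace Summit.QuantumFields.YangMills.Theorems.SpecificationRate.Negative

/-! ## The registered stub, verbatim (skeleton `SpecificationRate_bernstein.lean`, defs `G2`…`cB`, `ConditionalBernstein`) -/

/-- The gauge group `SU(2)` (skeleton `G2`). [folklore] -/
abbrev G2 : Type := Matrix.specialUnitaryGroup (Fin 2) ℂ

/-- The fixed unit-lattice configuration space `X₀ = SU(2)^{unit bonds}` (skeleton `X0`). [folklore] -/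
abbrev X0 (F : T3ContinuumYM3Torus.T3Family) : Type := GaugeField (F.P 0) 0 G2

/-- The σ-algebra generated by all unit links except `e` (skeleton `envSigma`). [folklore] -/
abbrev envSigma (F : T3ContinuumYM3Torus.T3Family) (e : PBond (F.P 0) 0) : MeasurableSpace (X0 F) :=
  MeasurableSpace.comap (fun (W : X0 F) (b : {b : PBond (F.P 0) 0 // b ≠ e}) => W b.1) MeasurableSpace.pi

/-- The conditionally centred log-increment at link `e`: `X_e = log h − E_μ[log h | links ≠ e]` (skeleton `ctr`). [folklore] -/
abbrev ctr (F : T3ContinuumYM3Torus.T3Family) (μ : Measure (X0 F)) (e : PBond (F.P 0) 0) (h : X0 F → ℝ) :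
    X0 F → ℝ :=
  fun V => Real.log (h V) - condExp (envSigma F e) μ (fun W => Real.log (h W)) V

/-- The Bernstein constant `e^{max(η,0)}/2` (skeleton `cB`). [folklore] -/
abbrev cB (η : ℝ) : ℝ := Real.exp (max η 0) / 2

/-- **The registered stub `stub_conditionalBernstein` of skeleton line «bernstein_rate» on stmt-QuantumFields-28041**,
verbatim: the `h`-WEIGHTED conditional Bernstein bridge. Refuted below. [folklore] -/
def ConditionalBernstein : Prop :=
  ∀ (F : T3ContinuumYM3Torus.T3Family) (μ : Measure (X0 F)), IsProbabilityMeasure μ →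
    ∀ (e : PBond (F.P 0) 0) (η : ℝ) (h : X0 F → ℝ), Measurable h → (∀ V, 0 < h V) → Integrable h μ →
      Integrable (fun V => Real.log (h V)) μ → Integrable (fun V => h V * (ctr F μ e h V) ^ 2) μ →
      (∀ᵐ V ∂μ, ctr F μ e h V ≤ η) →
      (∫ V, h V ∂μ) - ∫ V, (condExp (envSigma F e) μ (fun W => Real.sqrt (h W)) V) ^ 2 ∂μ
        ≤ cB η * ∫ V, h V * (ctr F μ e h V) ^ 2 ∂μ

/-! ## The two-atom witness -/

/-- Block size `L = 3`, volume exponent `m = 1`. [folklore] -/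
def F₀ : T3ContinuumYM3Torus.T3Family := ⟨3, ⟨by decide, by decide⟩, 1, le_rfl⟩

/-- The unit link at the origin in direction `0`. [folklore] -/
def e₀ : PBond (F₀.P 0) 0 := ⟨fun _ => 0, ⟨0, by simp⟩⟩

/-- `−1 ∈ SU(2)`. [folklore] -/
def gneg : G2 :=
  ⟨-1, by
    rw [Matrix.mem_specialUnitaryGroup_iff]
    refine ⟨?_, ?_⟩
    · rw [Matrix.mem_unitaryGroup_iff]; simp
    · simp [Matrix.det_neg, Matrix.det_one]⟩

/-- `−1 ≠ 1` in `SU(2)`. [folklore] -/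
theorem gneg_ne_one : gneg ≠ 1 := by
  intro h
  have h' := congrArg (fun g : G2 => (g : Matrix (Fin 2) (Fin 2) ℂ) 0 0) h
  simp [gneg] at h'
  norm_num at h'

/-- The trivial configuration `V₀ ≡ 1`. [folklore] -/
def V₀ : X0 F₀ := fun _ => 1

open scoped Classical in
/-- `V₁ = V₀` with the link `e₀` set to `−1`. [folklore] -/
def V₁ : X0 F₀ := Function.update V₀ e₀ gneg

/-- `V₁ e₀ = −1`. [folklore] -/
@[simp] theorem V₁_apply_e₀ : V₁ e₀ = gneg := by
  simp [V₁]

/-- `V₁` agrees with `V₀` off `e₀`. [folklore] -/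
theorem V₁_apply_of_ne {b : PBond (F₀.P 0) 0} (hb : b ≠ e₀) : V₁ b = V₀ b := by
  classical
  simp [V₁, hb]

/-- `V₀ e₀ = 1`. [folklore] -/
@[simp] theorem V₀_apply (b : PBond (F₀.P 0) 0) : V₀ b = 1 := rfl

open scoped Classical in
/-- The density: `e^{−10}` on `{V e₀ = −1}`, `1` elsewhere. [folklore] -/
def h₀ : X0 F₀ → ℝ := fun V => if V e₀ = gneg then Real.exp (-10) else 1

/-- `h₀ V₀ = 1`. [folklore] -/
@[simp] theorem h₀_V₀ : h₀ V₀ = 1 := by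
  simp [h₀, gneg_ne_one.symm]

/-- `h₀ V₁ = e^{−10}`. [folklore] -/
@[simp] theorem h₀_V₁ : h₀ V₁ = Real.exp (-10) := by
  simp [h₀]

/-- `h₀ > 0`. [folklore] -/
theorem h₀_pos (V : X0 F₀) : 0 < h₀ V := by
  unfold h₀; split_ifs
  · exact Real.exp_pos _
  · exact one_pos

/-- `h₀ ≤ 1`. [folklore] -/
theorem h₀_le_one (V : X0 F₀) : h₀ V ≤ 1 := by
  unfold h₀; split_ifs
  · exact Real.exp_le_one_iff.mpr (by norm_num)
  · exact le_rfl

/-- Singletons of `X₀(F₀)` are measurable (product of standard Borel `SU(2)` over finitely many links). [folklore] -/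
instance instMeasurableSingletonClassX0 : MeasurableSingletonClass (X0 F₀) :=
  inferInstanceAs (MeasurableSingletonClass (PBond (F₀.P 0) 0 → G2))

/-- `h₀` is measurable. [folklore] -/
theorem measurable_h₀ : Measurable h₀ := by
  classical
  have hm : Measurable (fun V : X0 F₀ => V e₀) := measurable_pi_apply e₀
  have hs : MeasurableSet {V : X0 F₀ | V e₀ = gneg} := hm (measurableSet_singleton gneg)
  exact Measurable.ite hs measurable_const measurable_const

/-- The two-atom law `μ₀ = 0.999·δ_{V₀} + 0.001·δ_{V₁}`. [folklore] -/
def μ₀ : Measure (X0 F₀) :=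
  ENNReal.ofReal (999 / 1000) • Measure.dirac V₀ + ENNReal.ofReal (1 / 1000) • Measure.dirac V₁

/-- `μ₀` is a probability measure. [folklore] -/
instance isProbabilityMeasure_μ₀ : IsProbabilityMeasure μ₀ := by
  refine ⟨?_⟩
  simp only [μ₀, Measure.add_apply, Measure.smul_apply, measure_univ, smul_eq_mul, mul_one]
  rw [← ENNReal.ofReal_add (by norm_num) (by norm_num)]
  norm_num

/-- Every real function is `μ₀`-integrable. [folklore] -/
theorem integrable_μ₀ (f : X0 F₀ → ℝ) : Integrable f μ₀ := by
  have hd : ∀ a : X0 F₀, Integrable f (Measure.dirac a) := fun a =>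
    (integrable_const (f a)).congr (ae_eq_dirac f).symm
  exact ((hd V₀).smul_measure ENNReal.ofReal_ne_top).add_measure ((hd V₁).smul_measure ENNReal.ofReal_ne_top)

/-- Integration against `μ₀`. [folklore] -/
theorem integral_μ₀ (f : X0 F₀ → ℝ) : ∫ V, f V ∂μ₀ = 999 / 1000 * f V₀ + 1 / 1000 * f V₁ := by
  have hd : ∀ a : X0 F₀, Integrable f (Measure.dirac a) := fun a =>
    (integrable_const (f a)).congr (ae_eq_dirac f).symm
  rw [μ₀, integral_add_measure ((hd V₀).smul_measure ENNReal.ofReal_ne_top)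
    ((hd V₁).smul_measure ENNReal.ofReal_ne_top), integral_smul_measure, integral_smul_measure,
    integral_dirac, integral_dirac, ENNReal.toReal_ofReal (by norm_num), ENNReal.toReal_ofReal (by norm_num),
    smul_eq_mul, smul_eq_mul]

/-- The environment map forgetting the link `e₀`. [folklore] -/
abbrev π₀ : X0 F₀ → ({b : PBond (F₀.P 0) 0 // b ≠ e₀} → G2) := fun W b => W b.1

/-- `V₀` and `V₁` have the same environment. [folklore] -/
theorem π₀_V₁ : π₀ V₁ = π₀ V₀ := by
  funext b
  exact V₁_apply_of_ne b.2

/-- The environment σ-algebra is a sub-σ-algebra. [folklore] -/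
theorem envSigma_le : envSigma F₀ e₀ ≤ (inferInstance : MeasurableSpace (X0 F₀)) :=
  (measurable_pi_lambda π₀ fun b => measurable_pi_apply (b.1 : PBond (F₀.P 0) 0)).comap_le

/-- Under the two-atom law every conditional expectation given the environment of `e₀` is the plain mean
(the two atoms share their environment). [folklore] -/
theorem condExp_μ₀ (f : X0 F₀ → ℝ) :
    (fun _ => ∫ V, f V ∂μ₀) =ᵐ[μ₀] condExp (envSigma F₀ e₀) μ₀ f := by
  classical
  haveI : IsFiniteMeasure (μ₀.trim envSigma_le) := isFiniteMeasure_trim envSigma_le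
  refine ae_eq_condExp_of_forall_setIntegral_eq envSigma_le (integrable_μ₀ f)
    (fun s _ _ => (integrable_const _).integrableOn) (fun s hs _ => ?_) aestronglyMeasurable_const
  obtain ⟨t, -, rfl⟩ := MeasurableSpace.measurableSet_comap.mp hs
  have hs' : MeasurableSet (π₀ ⁻¹' t) := envSigma_le _ hs
  have key : V₀ ∈ π₀ ⁻¹' t ↔ V₁ ∈ π₀ ⁻¹' t := by
    simp only [Set.mem_preimage, π₀_V₁]
  by_cases h0 : V₀ ∈ π₀ ⁻¹' t
  · have h1 : V₁ ∈ π₀ ⁻¹' t := key.mp h0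
    have hres : μ₀.restrict (π₀ ⁻¹' t) = μ₀ := by
      simp only [μ₀, Measure.restrict_add, Measure.restrict_smul, restrict_dirac' hs', if_pos h0, if_pos h1]
    rw [hres, integral_const, smul_eq_mul, probReal_univ, one_mul]
  · have h1 : V₁ ∉ π₀ ⁻¹' t := fun h => h0 (key.mpr h)
    have hres : μ₀.restrict (π₀ ⁻¹' t) = 0 := by
      simp only [μ₀, Measure.restrict_add, Measure.restrict_smul, restrict_dirac' hs', if_neg h0, if_neg h1,
        smul_zero, add_zero]
    rw [hres, integral_zero_measure, integral_zero_measure]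

/-! ## Numerical bounds -/

/-- `e^{−5} ≤ 1/100`. [folklore] -/
theorem exp_neg_five_le : Real.exp (-5) ≤ 1 / 100 := by
  have h1 : (27 / 10 : ℝ) < Real.exp 1 := lt_trans (by norm_num) Real.exp_one_gt_d9
  have h5 : Real.exp 5 = Real.exp 1 ^ 5 := by
    rw [Real.exp_one_pow]; norm_num
  have hge : (100 : ℝ) ≤ Real.exp 5 := by
    rw [h5]
    have : (27 / 10 : ℝ) ^ 5 ≤ Real.exp 1 ^ 5 := pow_le_pow_left₀ (by norm_num) h1.le 5
    nlinarith
  rw [Real.exp_neg, inv_eq_one_div]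
  exact one_div_le_one_div_of_le (by norm_num) hge

/-- `e^{1/100} ≤ 3`. [folklore] -/
theorem exp_hundredth_le : Real.exp (1 / 100) ≤ 3 := by
  have h : Real.exp (1 / 100) ≤ Real.exp 1 := Real.exp_le_exp.mpr (by norm_num)
  have h1 : Real.exp 1 < 2.7182818286 := Real.exp_one_lt_d9
  linarith

/-- `√(e^{−10}) = e^{−5}`. [folklore] -/
theorem sqrt_exp_neg_ten : Real.sqrt (Real.exp (-10)) = Real.exp (-5) := by
  rw [Real.sqrt_eq_iff_mul_self_eq_of_pos (Real.exp_pos _), ← Real.exp_add]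
  norm_num

/-! ## The refutation -/

/-- **The registered stub `stub_conditionalBernstein` (LINE 12 «bernstein_rate» on stmt-QuantumFields-28041) is FALSE.**
Witness: `F₀`, `μ₀ = 0.999δ_{V₀} + 0.001δ_{V₁}`, `e₀`, `η = 1/100`, `h₀`; energy `≥ 9.79·10⁻⁴`, right-hand side
`≤ 1.65·10⁻⁴`.  The weight in a true Bernstein bridge is the conditional geometric mean `m_e`, not `h`. [folklore] -/
theorem stub_conditionalBernstein_false : ¬ ConditionalBernstein := by
  intro H
  -- the conditional expectations given the environment of `e₀` are constants a.e.
  have hCEsqrt := condExp_μ₀ (fun W => Real.sqrt (h₀ W))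
  have hCElog := condExp_μ₀ (fun W => Real.log (h₀ W))
  have hIsqrt : ∫ V, Real.sqrt (h₀ V) ∂μ₀ = 999 / 1000 + 1 / 1000 * Real.exp (-5) := by
    rw [integral_μ₀]; simp [sqrt_exp_neg_ten]
  have hIlog : ∫ V, Real.log (h₀ V) ∂μ₀ = -(1 / 100) := by
    rw [integral_μ₀]; simp [Real.log_exp]; norm_num
  -- the centred increment is `log h₀ + 1/100` a.e.
  have hctr : ∀ᵐ V ∂μ₀, ctr F₀ μ₀ e₀ h₀ V = Real.log (h₀ V) + 1 / 100 := by
    filter_upwards [hCElog] with V hV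
    simp only [ctr, ← hV, hIlog]
    ring
  -- ceiling
  have hceil : ∀ᵐ V ∂μ₀, ctr F₀ μ₀ e₀ h₀ V ≤ 1 / 100 := by
    filter_upwards [hctr] with V hV
    rw [hV]
    have : Real.log (h₀ V) ≤ 0 := Real.log_nonpos (h₀_pos V).le (h₀_le_one V)
    linarith
  have hB := H F₀ μ₀ inferInstance e₀ (1 / 100) h₀ measurable_h₀ h₀_pos (integrable_μ₀ _) (integrable_μ₀ _)
    (integrable_μ₀ _) hceil
  -- evaluate the left-hand side
  have hL1 : ∫ V, h₀ V ∂μ₀ = 999 / 1000 + 1 / 1000 * Real.exp (-10) := by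
    rw [integral_μ₀]; simp
  have hL2 : ∫ V, (condExp (envSigma F₀ e₀) μ₀ (fun W => Real.sqrt (h₀ W)) V) ^ 2 ∂μ₀
      = (999 / 1000 + 1 / 1000 * Real.exp (-5)) ^ 2 := by
    have hae : (fun V => (condExp (envSigma F₀ e₀) μ₀ (fun W => Real.sqrt (h₀ W)) V) ^ 2)
        =ᵐ[μ₀] fun _ => (999 / 1000 + 1 / 1000 * Real.exp (-5)) ^ 2 := by
      filter_upwards [hCEsqrt] with V hV
      rw [← hV, hIsqrt]
    rw [integral_congr_ae hae, integral_const, smul_eq_mul, probReal_univ, one_mul]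
  -- evaluate the right-hand side
  have hR : ∫ V, h₀ V * (ctr F₀ μ₀ e₀ h₀ V) ^ 2 ∂μ₀
      = 999 / 1000 * (1 / 100) ^ 2 + 1 / 1000 * (Real.exp (-10) * (-10 + 1 / 100) ^ 2) := by
    have hae : (fun V => h₀ V * (ctr F₀ μ₀ e₀ h₀ V) ^ 2)
        =ᵐ[μ₀] fun V => h₀ V * (Real.log (h₀ V) + 1 / 100) ^ 2 := by
      filter_upwards [hctr] with V hV
      rw [hV]
    rw [integral_congr_ae hae, integral_μ₀]
    simp [Real.log_exp]
  have hcB : cB (1 / 100) = Real.exp (1 / 100) / 2 := by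
    simp only [cB, max_eq_left (show (0:ℝ) ≤ 1 / 100 by norm_num)]
  rw [hL1, hL2, hcB, hR] at hB
  -- numerics
  have ha0 : 0 < Real.exp (-5) := Real.exp_pos _
  have ha1 : Real.exp (-5) ≤ 1 / 100 := exp_neg_five_le
  have hb : Real.exp (-10) = Real.exp (-5) * Real.exp (-5) := by rw [← Real.exp_add]; norm_num
  have hc0 : 0 < Real.exp (1 / 100) := Real.exp_pos _
  have hc1 : Real.exp (1 / 100) ≤ 3 := exp_hundredth_le
  rw [hb] at hB
  have hsq : Real.exp (-5) * Real.exp (-5) ≤ 1 / 10000 := by nlinarith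
  have hprod : Real.exp (1 / 100) * (Real.exp (-5) * Real.exp (-5)) ≤ 3 * (1 / 10000) :=
    mul_le_mul hc1 hsq (by positivity) (by norm_num)
  nlinarith
end Summit.QuantumFields.YangMills.Theorems.SpecificationRate.Negative
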